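import Literature.MathematicalPhysics.QuantumFieldTheory.Balaban1983to89.T4FiniteEpsInhabited
import Literature.MathematicalPhysics.QuantumFieldTheory.Balaban1983to89.Node00.DatumAvLayer

/-!
# The carrier `FiniteEpsData F G` is inhabited by a datum OF RECORD (Stage 0) at which the pinned end statement (B) HOLDS —
# vacuously: an HONESTY CERTIFICATE for the Stage-0 typing of «(B) at the record» (converse of `Node00.N23Dossier` §5)

HONEST FRAMING.  Kernel bookkeeping about the TYPES, nothing about Bałaban's densities; one finite four-torus family at fixed ε;
nothing continuum ∕ ℝ⁴ ∕ OS ∕ mass gap ∕ Clay.  NO statement of the series [Balaban1983RegularityDecay]–[Balaban1989LargeFieldII] is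
proved or used.  Unit `pub-ymgap-dag-n13-b` (HUMAN RULING D-0062, Track A; prover seat of node N13 = [B16] Thm 1 + Cor 3, whose every
filing `--supports` the route item «StabilityBAtRecord», `stmt-QuantumFields-19183`).

WHAT THIS FILE SHOWS.  The sibling `T4FiniteEpsInhabited` (pub-balaban, row T4-D.G) inhabits `T4Continuum.FiniteEpsData F G` by a
LABELLED PLACEHOLDER whose construction has `Sect2Form := False`, so that [Balaban1989LargeFieldII] Thm 1 as typed (`B16.Thm1Printed`)
FAILS there and every conditional target holds vacuously (`not_endStatementBPrinted_stub`; `Node00.N23Dossier`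
`exists_isDatumOfRecord₀_not_endStatementBPrinted`).  THIS FILE records the CONVERSE hazard, which no tree file states: flipping the
placeholder's free predicate to `Sect2Form := True`, keeping `χ := 0`, and taking for Bałaban's *«reader-owned beyond (0.4)»* large-field
operation the MASS-FLATTENING `R ρ := (∫ρ dV)·1` (it preserves the integral (0.4) for EVERY density — `T4Continuum.Realisation` asks
nothing else of `R`), the densities become `ρ₀ = e^{−A/g₀²}` and `ρ_{k+1} ≡ ∫ Tρ_k dV = ∫ ρ₀ dU ≤ 1` (constants), and then
* `B16.Thm1Printed` holds TRIVIALLY (`Sect2Form k` is `True`),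
* [Balaban1988Convergent] Cor. 3 (2.50) as typed, `B16.Cor3_250`, holds with `e_± ≡ 0` (`χ_k = 0` kills the lower bound, `ρ_k ≤ 1 = e^{0·|T_η|}`
  the upper one),
* hence the PINNED end statement `B16.EndStatementBPrinted` (= Thm 1 ∧ Cor. 3) HOLDS at this datum (`endStatementBPrinted_flat`),
* the datum IS a datum of record at Stage 0 for `G = SU(N)` — `Node00.IsDatumOfRecord₀ F N D := D.av = avOfRecord F N` reads the
  averaging field only (`flatDataOfRecord`, `isDatumOfRecord₀_flatDataOfRecord`),
* and its runs enter every coupling window (constant flows `g_k = g₀`, zero β-functions, the run `(0, F.m, γ)`: `window_flat`).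
CONSEQUENCE (`exists_isDatumOfRecord₀_endStatementBPrinted_window`): for every family `F` and every `N ≥ 1`,
`∃ D : FiniteEpsData F SU(N), IsDatumOfRecord₀ F N D ∧ B16.EndStatementBPrinted D.C ∧ ∃ γ₁ > 0, ∀ γ ∈ ]0, γ₁], ∃ P, (D.C P).flow.InInterval γ P.K`
— at `N = 2` this is, word for word, the body of the route item `Summit.QuantumFields.YangMills.Theses.BalabanUVNodes.StabilityBAtRecord`
(route `route-QuantumFields-BalabanUVNodes`, rev 0, commit 363ed46d419e; crux rank 4, «difficulty XL»), which is therefore PROVABLE AT STAGE 0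
WITHOUT ANY OF BAŁABAN'S ANALYSIS.  The route file's own kill criterion names the repair: *«A refutation of StabilityBAtRecord at Stage 0
that exploits only the unpinned construction is class misstated: the repair is the Stage-5 restatement over Rec₅»* — the same holds for
this junk PROOF; its «CHEAPEST FALSIFIER (iii)» checked only the `Sect2Form := False` placeholder.  This file is the kernel witness of
weakness (D-0033 BC5) for that restatement; it is NOT filed as, and must not be read as, a proof of the crux.

WHAT IS *NOT* CLAIMED.  Nothing here bears on Bałaban's construction, on N13, or on whether the record of NODE 00 Stage 5 admits a
construction with (B) as printed.  The flattening `R` is junk by design (it is not Bałaban's 𝐑 of [Balaban1989LargeFieldI] (0.2)–(0.6));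
the point is only that the Stage-0 record predicate + `T4Continuum.Realisation` do not exclude it.  Every `def` below is a labelled
placeholder in the sense of `T4FiniteEpsInhabited` (whose §§1–3 API — `isRT_rnTransport_of_ac`, `integrable_rnTransport_of_ac`,
`zeroHBeta` — is used BY NAME) and of `Node00.DatumAvLayer` (`avOfRecord`, `avOfRecord_measurable`, `avOfRecord_haarAC`).
-/

noncomputable section

open MeasureTheory

namespace Literature.MathematicalPhysics.QuantumFieldTheory.Balaban1983to89.T4FiniteEpsInhabitedB

open Literature.MathematicalPhysics.QuantumFieldTheory.Balaban1983to89
open T4Continuum AveragingRT Missing T4FiniteEpsInhabited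

/-! ## 1. The mass-flattened iterates of the Wilson–Boltzmann weight -/

section Flat

variable (F : T4Family) {G : Type*} [GaugeGroup G] [MeasurableSpace G] [HaarData G]
  (av : (K j : ℕ) → Averaging (F.P K) j G)

/-- `ρ₀ := e^{−A(U)/g₀²}` (the Wilson–Boltzmann weight at `β = g₀⁻²`), `ρ_{k+1} :≡ ∫ T_{av K k} ρ_k dV` — the CONSTANT density obtained
by flattening the honest renormalisation transform (`AveragingRT.rnTransport`) of `ρ_k`: the iterates of `ρ ↦ R(Tρ)` for the junk
mass-flattening `R` of `flatRealisation`.  A labelled placeholder. [folklore] -/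
noncomputable def flatIterate (K : ℕ) (g₀ : ℝ) : (k : ℕ) → Density (F.P K) k G
  | 0 => boltzmann (F.P K) (g₀⁻¹ ^ 2)
  | k + 1 => fun _ => ∫ V, rnTransport (av K k).avg (flatIterate K g₀ k) V ∂fieldMeasure (F.P K) (k + 1) G

/-- `ρ_{k+1}` is the constant `∫ Tρ_k`. [folklore] -/
private theorem flatIterate_succ (K : ℕ) (g₀ : ℝ) (k : ℕ) (V : GaugeField (F.P K) (k + 1) G) :
    flatIterate F av K g₀ (k + 1) V =
      ∫ W, rnTransport (av K k).avg (flatIterate F av K g₀ k) W ∂fieldMeasure (F.P K) (k + 1) G := rfl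

/-- Every `ρ_k` is pointwise non-negative. [folklore] -/
private theorem flatIterate_nonneg (K : ℕ) (g₀ : ℝ) : ∀ (k : ℕ) (U : GaugeField (F.P K) k G), 0 ≤ flatIterate F av K g₀ k U
  | 0, U => (boltzmann_pos (F.P K) _ U).le
  | k + 1, _ => integral_nonneg fun V => rnTransport_nonneg _ _ (flatIterate_nonneg K g₀ k) V

variable [RegularGaugeGroup G]

/-- Every `ρ_k` is integrable (`ρ₀` by `integrable_boltzmann`, the constants trivially). [folklore] -/
private theorem integrable_flatIterate (K : ℕ) (g₀ : ℝ) :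
    ∀ k, Integrable (flatIterate F av K g₀ k) (fieldMeasure (F.P K) k G)
  | 0 => integrable_boltzmann RegularGaugeGroup.measurable_reTr (F.P K) (sq_nonneg _)
  | _ + 1 => integrable_const _

/-- Along a measurable family satisfying `HaarAC` in the standing range `k < K`: `ρ_k ≤ 1` pointwise for `k ≤ K` (`ρ₀ ≤ 1`; and
`ρ_{k+1} ≡ ∫ Tρ_k dV = ∫ ρ_k dU ≤ ∫ 1 dU = 1` by the push-forward identity `Setup.IsRT` at `f ≡ 1` and induction). [folklore] -/
private theorem flatIterate_le_one (hmeas : ∀ K j, Measurable (av K j).avg) (hac : ∀ K k, k < K → HaarAC (av K k).avg)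
    (K : ℕ) (g₀ : ℝ) : ∀ k, k ≤ K → ∀ U : GaugeField (F.P K) k G, flatIterate F av K g₀ k U ≤ 1
  | 0, _, U => boltzmann_le_one (F.P K) (sq_nonneg _) U
  | k + 1, hk, U => by
      have hk' : k < K := Nat.lt_of_succ_le hk
      have hT : IsRT (av K k).avg (flatIterate F av K g₀ k) (rnTransport (av K k).avg (flatIterate F av K g₀ k)) :=
        isRT_rnTransport_of_ac _ (hmeas K k) (hac K k hk') _ (integrable_flatIterate F av K g₀ k)
      have h1 := hT (fun _ => (1 : ℝ)) measurable_const ⟨1, fun _ => by simp⟩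
      simp only [mul_one] at h1
      rw [flatIterate_succ, h1]
      calc ∫ U, flatIterate F av K g₀ k U ∂fieldMeasure (F.P K) k G
          ≤ ∫ _, (1 : ℝ) ∂fieldMeasure (F.P K) k G :=
            integral_mono (integrable_flatIterate F av K g₀ k) (integrable_const _)
              fun W => flatIterate_le_one hmeas hac K g₀ k hk'.le W
        _ = 1 := by simp

end Flat

/-! ## 2. The placeholder construction with `Sect2Form := True`, and its forward generation -/

section Construction

variable (F : T4Family) (G : Type) [GaugeGroup G] [MeasurableSpace G] [HaarData G]
  (av : (K j : ℕ) → Averaging (F.P K) j G)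

/-- THE JUNK CONSTRUCTION: `T4FiniteEpsInhabited.stubConstruction` field by field (constant flow `g_k = g₀`, zero β-functions, `Cfg k` =
gauge fields on `T^{(k)}`, `dom := ∅`, `effAction = wilsonBG = Ek := 0`, `numSites := 0`, `Repr = IndAss := False`, `χ := 0`) EXCEPT
`ρ k := flatIterate` (flattened iterates) and **`Sect2Form := True`** — the free abstract predicate *«ρ_k has the form described in Sect. 2
[III]»* of `B16.RunData` set to `True`.  A labelled placeholder asserting NONE of Bałaban's representations. [folklore] -/
noncomputable def flatConstruction : B16.Construction := fun p =>
  { flow := ⟨fun _ => p.g0, fun _ _ => 0⟩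
    Cfg := fun k => GaugeField (F.P p.K) k G
    dom := fun _ => ∅
    effAction := fun _ _ => 0
    wilsonBG := fun _ _ => 0
    Ek := fun _ _ => 0
    numSites := fun _ => 0
    Repr := fun _ => False
    IndAss := fun _ => False
    ρ := fun k => flatIterate F av p.K p.g0 k
    χ := fun _ _ => 0
    Sect2Form := fun _ => True }

/-- The placeholder's one-variable β-functions are the zero family curried (both sides are `0`). [folklore] -/
private theorem curriesHBeta_flat : DagBinding.CurriesHBeta (flatConstruction F G av).toB12 zeroHBeta :=
  fun _ _ _ _ => rfl

/-- The constant flow is generated forward from the bare coupling by the zero β-functions. [folklore] -/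
private theorem forwardGenerated_flat : DagBinding.ForwardGenerated (flatConstruction F G av).toB12 zeroHBeta := by
  refine ⟨fun _ => rfl, fun p k _ hpos _ => ?_⟩
  have h0 : 0 < p.g0 := hpos 0 (Nat.zero_le _)
  refine ⟨h0, ?_⟩
  show 1 / p.g0 ^ 2 = 1 / p.g0 ^ 2 - 0
  rw [sub_zero]

/-- `χ_k ≥ 0` (with `χ := 0`): the sign convention `B16.SignConventions` at the placeholder. [cite: Balaban1989LargeFieldII, (0.1) p.356 (sign convention χ_k ≥ 0 of the typed reading; holds at the placeholder — bookkeeping, not a statement about the paper)] -/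
theorem signConventions_flat : B16.SignConventions (flatConstruction F G av) := fun _ _ _ => le_rfl

/-- **[Balaban1989LargeFieldII] Theorem 1 AS TYPED holds TRIVIALLY** for the placeholder: `Sect2Form k := True`. [cite: Balaban1989LargeFieldII, Thm 1 p.355 (typed form `B16.Thm1Printed` HOLDS VACUOUSLY at the `Sect2Form := True` placeholder — honesty certificate, not a statement about the paper)] -/
theorem thm1Printed_flat : B16.Thm1Printed (flatConstruction F G av) :=
  ⟨1, one_pos, fun _ _ _ _ => trivial⟩

/-- **The runs enter every coupling window**: for `γ > 0` the zero-step run `(0, F.m, γ)` has `g_0 = γ ∈ ]0, γ]` (the last conjunct of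
the route item «StabilityBAtRecord», with `γ₁ := 1`). [cite: Balaban1987RG1, (0.20) p.256 (constant flow `g_k = g₀`, zero β-functions, of the placeholder — bookkeeping, not a statement about the paper)] -/
theorem window_flat : ∃ γ₁ : ℝ, 0 < γ₁ ∧ ∀ γ : ℝ, 0 < γ → γ ≤ γ₁ →
    ∃ P : B12.RunParams, ((flatConstruction F G av) P).flow.InInterval γ P.K :=
  ⟨1, one_pos, fun γ hγ _ => ⟨⟨0, F.m, γ⟩, fun _ _ => ⟨hγ, le_rfl⟩⟩⟩

variable [RegularGaugeGroup G]

/-- **[Balaban1988Convergent] Cor. 3 (2.50) AS TYPED holds** for the placeholder with `e_± ≡ 0`: `χ_k = 0` makes the lower bound `0 ≤ ρ_k`,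
and `ρ_k ≤ 1 = e^{0}` (`flatIterate_le_one`, `k ≤ K`) is the upper bound. [cite: Balaban1988Convergent, Cor. 3 (2.50) p.264 (typed form `B16.Cor3_250` HOLDS VACUOUSLY at the placeholder — honesty certificate, not a statement about the paper)] -/
theorem cor3_flat (hmeas : ∀ K j, Measurable (av K j).avg) (hac : ∀ K k, k < K → HaarAC (av K k).avg) :
    B16.Cor3_250 (flatConstruction F G av) := by
  refine ⟨1, one_pos, fun _ => 0, fun _ => 0, fun P _ k hk V => ⟨?_, ?_⟩⟩
  · show (0 : ℝ) * _ ≤ flatIterate F av P.K P.g0 k V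
    rw [zero_mul]
    exact flatIterate_nonneg F av P.K P.g0 k V
  · show flatIterate F av P.K P.g0 k V ≤ Real.exp (0 * _)
    rw [zero_mul, Real.exp_zero]
    exact flatIterate_le_one F av hmeas hac P.K P.g0 k hk V

/-- **THE PINNED END STATEMENT (B) HOLDS AT THE PLACEHOLDER** (`EndStatementBPrinted := Thm1Printed ∧ Cor3_250`) — vacuously: no clause
of [III] §2 is asserted by `Sect2Form := True`. [cite: Balaban1989LargeFieldII, Thm 1 p.355 + p.391 (pinned (B) `B16.EndStatementBPrinted` HOLDS VACUOUSLY at the placeholder — honesty certificate, not a statement about the paper)] -/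
theorem endStatementBPrinted_flat (hmeas : ∀ K j, Measurable (av K j).avg) (hac : ∀ K k, k < K → HaarAC (av K k).avg) :
    B16.EndStatementBPrinted (flatConstruction F G av) :=
  ⟨thm1Printed_flat F G av, cor3_flat F G av hmeas hac⟩

/-- The STRONGER recorded reading `B16.EndStatementB` (run-uniform (0.1), `E_± = 0`) holds there as well. [cite: Balaban1989LargeFieldII, Thm 1 + (0.1) pp.355–356 (run-uniform reading `B16.EndStatementB` HOLDS VACUOUSLY at the placeholder — honesty certificate, not a statement about the paper)] -/
theorem endStatementB_flat (hmeas : ∀ K j, Measurable (av K j).avg) (hac : ∀ K k, k < K → HaarAC (av K k).avg) :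
    B16.EndStatementB (flatConstruction F G av) := by
  refine ⟨thm1Printed_flat F G av, 1, one_pos, 0, 0, fun P _ k hk V => ⟨?_, ?_⟩⟩
  · show (0 : ℝ) * _ ≤ flatIterate F av P.K P.g0 k V
    rw [zero_mul]
    exact flatIterate_nonneg F av P.K P.g0 k V
  · show flatIterate F av P.K P.g0 k V ≤ Real.exp (0 * _)
    rw [zero_mul, Real.exp_zero]
    exact flatIterate_le_one F av hmeas hac P.K P.g0 k hk V

/-- THE JUNK REALISATION: `cfg` = identity, `ρ₀` = the Boltzmann weight (`c = 1`), `Tρ_k` = the Radon–Nikodym transport of `ρ_k` along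
`av K k` (an honest `Setup.IsRT` transform, given measurability and `HaarAC` in the standing range), and the MASS-FLATTENING
`R ρ := (∫ρ dV)·1` — integral-preserving for EVERY `ρ` on the probability space of configurations, which is all (0.4) =
`Setup.PreservesIntegral` asks; `ρ_{k+1} = R(Tρ_k)` by definition. [folklore] -/
noncomputable def flatRealisation (hmeas : ∀ K j, Measurable (av K j).avg) (hac : ∀ K k, k < K → HaarAC (av K k).avg) :
    T4Continuum.Realisation F G (flatConstruction F G av) av where
  cfg := fun _ _ _ => Equiv.refl _
  rho_zero := fun _ _ => ⟨1, one_pos, fun _ => (one_mul _).symm⟩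
  Trho := fun K g₀ k => rnTransport (av K k).avg (flatIterate F av K g₀ k)
  isRT_Trho := fun K g₀ k hk =>
    isRT_rnTransport_of_ac _ (hmeas K k) (hac K k hk) _ (integrable_flatIterate F av K g₀ k)
  R := fun K _ k ρ => fun _ => ∫ V, ρ V ∂fieldMeasure (F.P K) (k + 1) G
  preservesIntegral_R := fun K _ k _ ρ => by simp
  rho_succ_eq := fun _ _ _ _ => rfl

/-- THE INHABITANT: finite-`ε` data with the GIVEN averagings on the `Sect2Form := True` placeholder. [folklore] -/
noncomputable def flatData (hmeas : ∀ K j, Measurable (av K j).avg) (hac : ∀ K k, k < K → HaarAC (av K k).avg) :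
    T4Continuum.FiniteEpsData F G where
  C := flatConstruction F G av
  βfun := zeroHBeta
  curries := curriesHBeta_flat F G av
  fwd := forwardGenerated_flat F G av
  av := av
  real := flatRealisation F G av hmeas hac

end Construction

/-! ## 3. At the record, Stage 0: the converse of `Node00.N23Dossier` §5 -/

section Record

variable (F : T4Family) (N : ℕ) [NeZero N]

/-- THE JUNK DATUM OF RECORD (Stage 0) on `SU(N)`: `flatData` driven by NODE 00's averaging of record `Node00.avOfRecord F N`
(measurable, `HaarAC` in the standing range — `Node00.avOfRecord_measurable`, `Node00.avOfRecord_haarAC`). [folklore] -/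
noncomputable def flatDataOfRecord : T4Continuum.FiniteEpsData F (Node00.SU N) :=
  flatData F (Node00.SU N) (Node00.avOfRecord F N) (Node00.avOfRecord_measurable F N) (Node00.avOfRecord_haarAC F N)

/-- It IS a datum of record at Stage 0 (`IsDatumOfRecord₀ := D.av = avOfRecord F N` reads the averaging field only). [cite: Balaban1987RG1, (0.3)–(0.4) p.253 (Stage-0 record predicate = the averaging of record; bookkeeping)] -/
theorem isDatumOfRecord₀_flatDataOfRecord : Node00.IsDatumOfRecord₀ F N (flatDataOfRecord F N) := rfl

/-- (B) as pinned HOLDS at it. [cite: Balaban1989LargeFieldII, Thm 1 p.355 + p.391 (pinned (B) HOLDS VACUOUSLY at the junk datum of record — honesty certificate, not a statement about the paper)] -/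
theorem endStatementBPrinted_flatDataOfRecord : B16.EndStatementBPrinted (flatDataOfRecord F N).C :=
  endStatementBPrinted_flat F (Node00.SU N) (Node00.avOfRecord F N) (Node00.avOfRecord_measurable F N)
    (Node00.avOfRecord_haarAC F N)

/-- **HONESTY CERTIFICATE (converse of `Node00.N23Dossier.exists_isDatumOfRecord₀_not_endStatementBPrinted`)**: on every family and every
`N ≥ 1` there is a datum of record (Stage 0) at which the PINNED end statement (B) HOLDS, the sign convention holds, and whose runs enter
every coupling window — built from NO statement of the series.  At `N = 2` the three conjuncts after `IsDatumOfRecord₀` are, word for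
word, the body of the route item «StabilityBAtRecord» (`stmt-QuantumFields-19183`, rank-4 crux of `route-QuantumFields-BalabanUVNodes`,
rev 0): the item AS TYPED AT STAGE 0 is junk-provable and must be restated over NODE 00's Stage-5 record predicate (its own kill
criterion: «class misstated … the repair is the Stage-5 restatement over Rec₅»). [cite: Balaban1989LargeFieldII, Thm 1 p.355 + p.391 (pinned (B) and the coupling window HOLD VACUOUSLY at a Stage-0 datum of record — honesty certificate for the typed reading, not a statement about the paper)] -/
theorem exists_isDatumOfRecord₀_endStatementBPrinted_window :
    ∃ D : T4Continuum.FiniteEpsData F (Matrix.specialUnitaryGroup (Fin N) ℂ),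
      Node00.IsDatumOfRecord₀ F N D ∧ B16.EndStatementBPrinted D.C ∧ B16.SignConventions D.C ∧
        ∃ γ₁ : ℝ, 0 < γ₁ ∧ ∀ γ : ℝ, 0 < γ → γ ≤ γ₁ → ∃ P : B12.RunParams, (D.C P).flow.InInterval γ P.K :=
  ⟨flatDataOfRecord F N, isDatumOfRecord₀_flatDataOfRecord F N, endStatementBPrinted_flatDataOfRecord F N,
    signConventions_flat F _ _, window_flat F _ _⟩

/-- The same with the STRONGER run-uniform reading `B16.EndStatementB` (Theorem 1 ∧ (0.1) with `E_±` before the run). [cite: Balaban1989LargeFieldII, Thm 1 + (0.1) pp.355–356 (run-uniform reading HOLDS VACUOUSLY at a Stage-0 datum of record — honesty certificate, not a statement about the paper)] -/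
theorem exists_isDatumOfRecord₀_endStatementB :
    ∃ D : T4Continuum.FiniteEpsData F (Matrix.specialUnitaryGroup (Fin N) ℂ),
      Node00.IsDatumOfRecord₀ F N D ∧ B16.EndStatementB D.C :=
  ⟨flatDataOfRecord F N, isDatumOfRecord₀_flatDataOfRecord F N,
    endStatementB_flat F (Node00.SU N) (Node00.avOfRecord F N) (Node00.avOfRecord_measurable F N)
      (Node00.avOfRecord_haarAC F N)⟩

end Record

/-! ## 4. The endpoint-existence clause of [Balaban1987RG1] Thm 2 AS TYPED is equally junk-satisfiable (constant flows) -/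

/-- **`DagBinding.EndpointExistence` AS TYPED holds for the placeholder**: with the constant flow `g_k = g₀` of every run, the bare
coupling `g₀ := g` ends at `g_K = g` and stays in `]0, γ]` for `g ≤ γ` (take `γ₂ := 1`, `g⋆ := γ`). [cite: Balaban1987RG1, Thm 2 p.259 (endpoint-existence half, typed form `DagBinding.EndpointExistence`, HOLDS VACUOUSLY at the constant-flow placeholder — honesty certificate, not a statement about the paper)] -/
theorem endpointExistence_flat (F : T4Family) (G : Type) [GaugeGroup G] [MeasurableSpace G] [HaarData G]
    (av : (K j : ℕ) → Averaging (F.P K) j G) : DagBinding.EndpointExistence (flatConstruction F G av).toB12 :=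
  fun _ => ⟨1, one_pos, fun γ hγ _ => ⟨γ, hγ, fun g hg hgγ _ => ⟨g, fun _ _ => ⟨hg, hgγ⟩, rfl⟩⟩⟩

/-- **HONESTY CERTIFICATE, endpoint form**: on every family and every `N ≥ 1` there is a datum of record (Stage 0) at which the pinned
(B) AND the endpoint-existence clause hold — built from NO statement of the series.  At `N = 2` this is, word for word, the
CONCLUSION of the route item «EndpointGivenB» (`stmt-QuantumFields-19181`, rank-2 crux «= NODE O» of `route-QuantumFields-BalabanUVNodes`,
rev 0), which is therefore junk-provable at Stage 0 as well (its antecedent is not even needed); same repair (restate over the Stage-5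
record predicate pinning `D.C`, `χ`, `R` and the β-functions). [cite: Balaban1987RG1, Thm 2 p.259 (pinned (B) ∧ endpoint existence HOLD VACUOUSLY at a Stage-0 datum of record — honesty certificate for the typed reading, not a statement about the paper)] -/
theorem exists_isDatumOfRecord₀_endStatementBPrinted_endpoint (F : T4Family) (N : ℕ) [NeZero N] :
    ∃ D : T4Continuum.FiniteEpsData F (Matrix.specialUnitaryGroup (Fin N) ℂ),
      Node00.IsDatumOfRecord₀ F N D ∧ B16.EndStatementBPrinted D.C ∧ DagBinding.EndpointExistence D.C.toB12 :=
  ⟨flatDataOfRecord F N, isDatumOfRecord₀_flatDataOfRecord F N, endStatementBPrinted_flatDataOfRecord F N,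
    endpointExistence_flat F _ _⟩


/-! ## 5. The four LEVERS of the exploit, over an ARBITRARY construction (what a record predicate must remove)

Each theorem below isolates ONE freedom of the rev-0 typing, with no datum and no flattening in the hypotheses: (L1) a trivially
satisfied clause field `Sect2Form` gives Theorem 1 as typed; (L2) `χ ≡ 0` together with densities in `[0, 1]` gives [III] Cor. 3 as typed
(and the run-uniform (0.1)); (L3) constant coupling flows give the endpoint-existence clause of [I] Thm 2 as typed; (L4) the «window»
clause `∃ P, InInterval γ P.K` holds for EVERY forward-generated datum (zero-step run) — it is no guard at all.  A rev-1 record predicate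
defeats the flat datum iff it removes (L1)–(L3) BY DEFINITION (pins `Sect2Form`, `χ_k`, Bałaban's `R` — which forces the densities —
and the β-functions), and the window needs `K ≥ 1`. -/

section Levers

variable {F : T4Family} {G : Type*} [GaugeGroup G] [MeasurableSpace G] [HaarData G]

/-- **(L1)** A construction whose clause field `Sect2Form` holds identically satisfies [Balaban1989LargeFieldII] Theorem 1 AS TYPED. [cite: Balaban1989LargeFieldII, Thm 1 p.355 (typed form `B16.Thm1Printed`; lever of the Stage-0 vacuity — bookkeeping, not a statement about the paper)] -/
theorem thm1Printed_of_sect2Form (C : B16.Construction) (h : ∀ P k, (C P).Sect2Form k) : B16.Thm1Printed C :=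
  ⟨1, one_pos, fun P _ k _ => h P k⟩

/-- **(L2)** A construction with `χ ≡ 0` and densities in `[0, 1]` satisfies [Balaban1988Convergent] Cor. 3 (2.50) AS TYPED with
`e_± ≡ 0` — whatever its flows, configurations and site counts. [cite: Balaban1988Convergent, Cor. 3 (2.50) p.264 (typed form `B16.Cor3_250`; lever of the Stage-0 vacuity — bookkeeping, not a statement about the paper)] -/
theorem cor3_of_chi_zero_of_rho_le_one (C : B16.Construction) (hχ : ∀ P k V, (C P).χ k V = 0)
    (hρ : ∀ P k V, k ≤ P.K → 0 ≤ (C P).ρ k V ∧ (C P).ρ k V ≤ 1) : B16.Cor3_250 C := by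
  refine ⟨1, one_pos, fun _ => 0, fun _ => 0, fun P _ k hk V => ⟨?_, ?_⟩⟩
  · rw [hχ, zero_mul]; exact (hρ P k V hk).1
  · rw [zero_mul, Real.exp_zero]; exact (hρ P k V hk).2

/-- (L2′) The same two levers give the STRONGER run-uniform (0.1) `B16.UVBound01` (`E_± = 0`). [cite: Balaban1989LargeFieldII, (0.1) p.356 (typed run-uniform form `B16.UVBound01`; lever of the Stage-0 vacuity — bookkeeping)] -/
theorem uvBound01_of_chi_zero_of_rho_le_one (C : B16.Construction) (hχ : ∀ P k V, (C P).χ k V = 0)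
    (hρ : ∀ P k V, k ≤ P.K → 0 ≤ (C P).ρ k V ∧ (C P).ρ k V ≤ 1) : B16.UVBound01 C := by
  refine ⟨1, one_pos, 0, 0, fun P _ k hk V => ⟨?_, ?_⟩⟩
  · rw [hχ, zero_mul]; exact (hρ P k V hk).1
  · rw [zero_mul, Real.exp_zero]; exact (hρ P k V hk).2

/-- **(L3)** A construction with CONSTANT coupling flows `g_k = g₀` satisfies the endpoint-existence clause of [Balaban1987RG1] Thm 2 AS TYPED
(`γ₂ := 1`, `g⋆ := γ`, `g₀ := g`). [cite: Balaban1987RG1, Thm 2 p.259 (typed form `DagBinding.EndpointExistence`; lever of the Stage-0 vacuity — bookkeeping, not a statement about the paper)] -/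
theorem endpointExistence_of_constFlow (C : B12.Construction) (h : ∀ P k, (C P).flow.g k = P.g0) :
    DagBinding.EndpointExistence C :=
  fun m => ⟨1, one_pos, fun γ hγ _ => ⟨γ, hγ, fun g hg hgγ K =>
    ⟨g, fun k _ => by rw [h ⟨K, m, g⟩ k]; exact ⟨hg, hgγ⟩, h ⟨K, m, g⟩ K⟩⟩⟩

/-- **(L4)** The «window» clause `∃ γ₁ > 0, ∀ γ ∈ ]0, γ₁], ∃ P, (D.C P).flow.InInterval γ P.K` of the rev-0 item holds for EVERY finite-ε datum
whatsoever: the zero-step run `(0, F.m, γ)` has `g_0 = γ` by forward generation (`T4Continuum.FiniteEpsData.flow_zero`).  It is not a guard;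
a non-vacuous window needs `K ≥ 1`. [cite: Balaban1987RG1, (0.17)–(0.20) p.255 (forward generation ⇒ the typed zero-step window is automatic — bookkeeping)] -/
theorem window_of_finiteEpsData (D : FiniteEpsData F G) :
    ∃ γ₁ : ℝ, 0 < γ₁ ∧ ∀ γ : ℝ, 0 < γ → γ ≤ γ₁ → ∃ P : B12.RunParams, (D.C P).flow.InInterval γ P.K :=
  ⟨1, one_pos, fun γ hγ _ => ⟨⟨0, F.m, γ⟩, fun k hk => by
    obtain rfl : k = 0 := Nat.le_zero.mp hk
    rw [D.flow_zero]; exact ⟨hγ, le_rfl⟩⟩⟩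

end Levers

/-! ## 6. The flat FAMILY: every field the exploit does not use is free — cosmetic pins do not repair the item -/

section Family

variable (F : T4Family) (G : Type) [GaugeGroup G] [MeasurableSpace G] [HaarData G]
  (av : (K j : ℕ) → Averaging (F.P K) j G)

/-- The fields of `B16.RunData` the exploit never touches, as free parameters per run: site counts, small-field domains, effective
actions, background Wilson actions, `E_k`, and the clause fields `Repr`, `IndAss` ([Balaban1987RG1] (0.22)–(0.24) ∕ inductive
assumptions).  A record predicate pinning ONLY these (to Bałaban's values or anything else) leaves the item vacuous (`flatDataWith_junk`). [cite: Balaban1987RG1, (0.22)–(0.24) p.256 (dictionary of the fields of `B16.RunData` the Stage-0 exploit leaves untouched; bookkeeping, not a statement about the paper)] -/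
structure FlatAux where
  numSites : B12.RunParams → ℕ → ℕ
  dom : (p : B12.RunParams) → (k : ℕ) → Set (GaugeField (F.P p.K) k G)
  effAction : (p : B12.RunParams) → (k : ℕ) → GaugeField (F.P p.K) k G → ℝ
  wilsonBG : (p : B12.RunParams) → (k : ℕ) → GaugeField (F.P p.K) k G → ℝ
  Ek : (p : B12.RunParams) → (k : ℕ) → GaugeField (F.P p.K) k G → ℝ
  Repr : B12.RunParams → ℕ → Prop
  IndAss : B12.RunParams → ℕ → Prop

/-- The flat construction with the free fields set to `aux` (only `flow`, `ρ`, `χ`, `Sect2Form` are as in `flatConstruction`). [folklore] -/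
noncomputable def flatConstructionWith (aux : FlatAux F G) : B16.Construction := fun p =>
  { flow := ⟨fun _ => p.g0, fun _ _ => 0⟩
    Cfg := fun k => GaugeField (F.P p.K) k G
    dom := aux.dom p
    effAction := aux.effAction p
    wilsonBG := aux.wilsonBG p
    Ek := aux.Ek p
    numSites := aux.numSites p
    Repr := aux.Repr p
    IndAss := aux.IndAss p
    ρ := fun k => flatIterate F av p.K p.g0 k
    χ := fun _ _ => 0
    Sect2Form := fun _ => True }

/-- Forward generation of the constant flow by the zero β-functions (as for `flatConstruction`). [folklore] -/
private theorem forwardGenerated_flatWith (aux : FlatAux F G) :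
    DagBinding.ForwardGenerated (flatConstructionWith F G av aux).toB12 zeroHBeta := by
  refine ⟨fun _ => rfl, fun p k _ hpos _ => ?_⟩
  have h0 : 0 < p.g0 := hpos 0 (Nat.zero_le _)
  refine ⟨h0, ?_⟩
  show 1 / p.g0 ^ 2 = 1 / p.g0 ^ 2 - 0
  rw [sub_zero]

variable [RegularGaugeGroup G]

/-- The realisation of every member of the family: honest RN transport along `av`, mass-flattening `R` (as `flatRealisation`). [folklore] -/
noncomputable def flatRealisationWith (aux : FlatAux F G) (hmeas : ∀ K j, Measurable (av K j).avg)
    (hac : ∀ K k, k < K → HaarAC (av K k).avg) : T4Continuum.Realisation F G (flatConstructionWith F G av aux) av where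
  cfg := fun _ _ _ => Equiv.refl _
  rho_zero := fun _ _ => ⟨1, one_pos, fun _ => (one_mul _).symm⟩
  Trho := fun K g₀ k => rnTransport (av K k).avg (flatIterate F av K g₀ k)
  isRT_Trho := fun K g₀ k hk =>
    isRT_rnTransport_of_ac _ (hmeas K k) (hac K k hk) _ (integrable_flatIterate F av K g₀ k)
  R := fun K _ k ρ => fun _ => ∫ V, ρ V ∂fieldMeasure (F.P K) (k + 1) G
  preservesIntegral_R := fun K _ k _ ρ => by simp
  rho_succ_eq := fun _ _ _ _ => rfl

/-- The family of junk data, one per `aux`. [folklore] -/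
noncomputable def flatDataWith (aux : FlatAux F G) (hmeas : ∀ K j, Measurable (av K j).avg)
    (hac : ∀ K k, k < K → HaarAC (av K k).avg) : T4Continuum.FiniteEpsData F G where
  C := flatConstructionWith F G av aux
  βfun := zeroHBeta
  curries := fun _ _ _ _ => rfl
  fwd := forwardGenerated_flatWith F G av aux
  av := av
  real := flatRealisationWith F G av aux hmeas hac

/-- **THE WHOLE FAMILY IS JUNK-GOOD**: for EVERY choice `aux` of the untouched fields, the datum `flatDataWith aux` satisfies the pinned (B),
the run-uniform `EndStatementB`, the sign convention, the endpoint-existence clause and the window — by the four levers of §5.  Hence a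
rev-1 record predicate satisfied by `flatDataWith aux` for SOME `aux` (e.g. one pinning only `numSites`, `dom`, `effAction`, `wilsonBG`,
`Ek`, `Repr`, `IndAss` — to anything, including Bałaban's values) leaves the restated items exactly as vacuous as rev 0. [cite: Balaban1989LargeFieldII, Thm 1 p.355 + p.391 (typed (B) ∧ endpoint ∧ window HOLD VACUOUSLY on the whole flat family — honesty certificate for the typed reading, not a statement about the paper)] -/
theorem flatDataWith_junk (aux : FlatAux F G) (hmeas : ∀ K j, Measurable (av K j).avg)
    (hac : ∀ K k, k < K → HaarAC (av K k).avg) :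
    B16.EndStatementBPrinted (flatDataWith F G av aux hmeas hac).C ∧ B16.EndStatementB (flatDataWith F G av aux hmeas hac).C ∧
      B16.SignConventions (flatDataWith F G av aux hmeas hac).C ∧
      DagBinding.EndpointExistence (flatDataWith F G av aux hmeas hac).C.toB12 ∧
      ∃ γ₁ : ℝ, 0 < γ₁ ∧ ∀ γ : ℝ, 0 < γ → γ ≤ γ₁ →
        ∃ P : B12.RunParams, ((flatDataWith F G av aux hmeas hac).C P).flow.InInterval γ P.K := by
  have h1 : B16.Thm1Printed (flatConstructionWith F G av aux) :=
    thm1Printed_of_sect2Form _ fun _ _ => trivial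
  have hρ : ∀ (P : B12.RunParams) k (V : GaugeField (F.P P.K) k G), k ≤ P.K →
      0 ≤ flatIterate F av P.K P.g0 k V ∧ flatIterate F av P.K P.g0 k V ≤ 1 :=
    fun P k V hk => ⟨flatIterate_nonneg F av P.K P.g0 k V, flatIterate_le_one F av hmeas hac P.K P.g0 k hk V⟩
  refine ⟨⟨h1, cor3_of_chi_zero_of_rho_le_one _ (fun _ _ _ => rfl) hρ⟩,
    ⟨h1, uvBound01_of_chi_zero_of_rho_le_one _ (fun _ _ _ => rfl) hρ⟩, fun _ _ _ => le_rfl,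
    endpointExistence_of_constFlow _ fun _ _ => rfl, window_of_finiteEpsData _⟩

end Family

/-! ## 7. Regression certificates for rev 1: which pins the flat family FAILS (templates over an abstract record predicate) -/

section Pins

variable (F : T4Family) (N : ℕ) [NeZero N]

/-- THE FLAT FAMILY AT THE RECORD (Stage 0), one junk datum of record per `aux`. [folklore] -/
noncomputable def flatDataOfRecordWith (aux : FlatAux F (Node00.SU N)) : T4Continuum.FiniteEpsData F (Node00.SU N) :=
  flatDataWith F (Node00.SU N) (Node00.avOfRecord F N) aux (Node00.avOfRecord_measurable F N) (Node00.avOfRecord_haarAC F N)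

/-- Every member IS a datum of record at Stage 0 (`rfl`). [cite: Balaban1987RG1, (0.3)–(0.4) p.253 (Stage-0 record predicate = the averaging of record; bookkeeping)] -/
theorem isDatumOfRecord₀_flatDataOfRecordWith (aux : FlatAux F (Node00.SU N)) :
    Node00.IsDatumOfRecord₀ F N (flatDataOfRecordWith F N aux) := rfl

/-- **REV 1 STAYS VACUOUS IF ITS RECORD PREDICATE MEETS THE FLAT FAMILY**: for any `Rec`, a member `flatDataOfRecordWith aux` satisfying `Rec`
witnesses `∃ D, Rec D ∧ IsDatumOfRecord₀ ∧ (B) ∧ EndpointExistence ∧ window` — the shape of all three restated items' ∃-faces — with no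
statement of the series used.  The planners' turnkey check: rev 1 is acceptable only if `∀ aux, ¬ Rec (flatDataOfRecordWith F 2 aux)` (see the
`not_rec_flatWith_of_pins*` templates for sufficient conditions). [cite: Balaban1989LargeFieldII, Thm 1 p.355 + p.391 (regression certificate for the typed reading of (B) at a record predicate; bookkeeping, not a statement about the paper)] -/
theorem vacuous_of_rec_flatWith {Rec : T4Continuum.FiniteEpsData F (Node00.SU N) → Prop} (aux : FlatAux F (Node00.SU N))
    (h : Rec (flatDataOfRecordWith F N aux)) :
    ∃ D : T4Continuum.FiniteEpsData F (Matrix.specialUnitaryGroup (Fin N) ℂ),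
      Rec D ∧ Node00.IsDatumOfRecord₀ F N D ∧ B16.EndStatementBPrinted D.C ∧ DagBinding.EndpointExistence D.C.toB12 ∧
        ∃ γ₁ : ℝ, 0 < γ₁ ∧ ∀ γ : ℝ, 0 < γ → γ ≤ γ₁ → ∃ P : B12.RunParams, (D.C P).flow.InInterval γ P.K := by
  obtain ⟨hB, -, -, hE, hW⟩ :=
    flatDataWith_junk F (Node00.SU N) (Node00.avOfRecord F N) aux (Node00.avOfRecord_measurable F N)
      (Node00.avOfRecord_haarAC F N)
  exact ⟨flatDataOfRecordWith F N aux, h, rfl, hB, hE, hW⟩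

/-- **Template (χ-pin)**: a record predicate under which SOME small-field characteristic function takes a non-zero value (e.g. `χ_k` pinned
to the (2.17) [III] characteristic functions, which equal `1` at `V = 1`) FAILS on the whole flat family. [cite: Balaban1988Convergent, (2.17) p.257 (χ_k pinned ⇒ the flat family is excluded — regression certificate; bookkeeping)] -/
theorem not_rec_flatWith_of_pinsChi {Rec : T4Continuum.FiniteEpsData F (Node00.SU N) → Prop}
    (h : ∀ D, Rec D → ∃ (P : B12.RunParams) (k : ℕ) (V : (D.C P).Cfg k), (D.C P).χ k V ≠ 0)
    (aux : FlatAux F (Node00.SU N)) : ¬ Rec (flatDataOfRecordWith F N aux) := by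
  intro hR
  obtain ⟨P, k, V, hne⟩ := h _ hR
  exact hne rfl

/-- **Template (R-pin)**: a record predicate under which Bałaban's large-field operation is, at SOME run ∕ step ∕ density ∕ point, NOT the
mass-flattening `ρ ↦ (∫ρ)·1` (e.g. `R` pinned to [Balaban1989LargeFieldII] (1.72) ∕ [IV] (0.2)–(0.6), which is the identity on densities
without large fields) FAILS on the whole flat family. [cite: Balaban1989LargeFieldI, (0.2)–(0.6) pp.175–177 (R pinned ⇒ the flat family is excluded — regression certificate; bookkeeping)] -/
theorem not_rec_flatWith_of_pinsR {Rec : T4Continuum.FiniteEpsData F (Node00.SU N) → Prop}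
    (h : ∀ D, Rec D → ∃ (K : ℕ) (g₀ : ℝ) (k : ℕ) (ρ : Density (F.P K) (k + 1) (Node00.SU N))
      (V : GaugeField (F.P K) (k + 1) (Node00.SU N)),
        D.real.R K g₀ k ρ V ≠ ∫ W, ρ W ∂fieldMeasure (F.P K) (k + 1) (Node00.SU N))
    (aux : FlatAux F (Node00.SU N)) : ¬ Rec (flatDataOfRecordWith F N aux) := by
  intro hR
  obtain ⟨K, g₀, k, ρ, V, hne⟩ := h _ hR
  exact hne rfl

/-- **Template (flow-pin)**: a record predicate under which SOME run's coupling MOVES (`g_k ≠ g_0` for some `k`; e.g. `βfun` pinned to the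
[I] (1.20)–(1.22) β-functions with `β_1 ≠ 0`) FAILS on the whole flat family (constant flows). [cite: Balaban1987RG1, (0.20) p.256 (β pinned non-zero ⇒ the flat family is excluded — regression certificate; bookkeeping)] -/
theorem not_rec_flatWith_of_pinsFlow {Rec : T4Continuum.FiniteEpsData F (Node00.SU N) → Prop}
    (h : ∀ D, Rec D → ∃ (P : B12.RunParams) (k : ℕ), (D.C P).flow.g k ≠ (D.C P).flow.g 0)
    (aux : FlatAux F (Node00.SU N)) : ¬ Rec (flatDataOfRecordWith F N aux) := by
  intro hR
  obtain ⟨P, k, hne⟩ := h _ hR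
  exact hne rfl

/-- **Template (Sect2Form-pin, the Thm-1 lever)**: a record predicate under which the clause field `Sect2Form k` of SOME run is EQUIVALENT to
a proposition that FAILS for that run's flat data (the [III] §2 description read on constant densities with zero characteristic functions —
to be supplied by the Stage-5 definition) fails on the member.  Stated abstractly: if `Rec D` forces `¬ (D.C P).Sect2Form k` somewhere
whenever `D.C`'s `χ` vanishes identically, the flat family is excluded. [cite: Balaban1988Convergent, §2 pp.254–264 (Sect2Form pinned ⇒ exclusion criterion — regression template; bookkeeping)] -/
theorem not_rec_flatWith_of_pinsSect2Form {Rec : T4Continuum.FiniteEpsData F (Node00.SU N) → Prop}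
    (h : ∀ D, Rec D → (∀ (P : B12.RunParams) (k : ℕ) (V : (D.C P).Cfg k), (D.C P).χ k V = 0) →
      ∃ (P : B12.RunParams) (k : ℕ), ¬ (D.C P).Sect2Form k)
    (aux : FlatAux F (Node00.SU N)) : ¬ Rec (flatDataOfRecordWith F N aux) := by
  intro hR
  obtain ⟨P, k, hne⟩ := h _ hR (fun _ _ _ => rfl)
  exact hne trivial

end Pins

end Literature.MathematicalPhysics.QuantumFieldTheory.Balaban1983to89.T4FiniteEpsInhabitedB

end
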